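import Literature.MathematicalPhysics.QuantumFieldTheory.Balaban1983to89.T4HistoryLipschitzRescaling

/-!
# NE9MultiScaleChart — Bałaban's multi-scale family of localization domains 𝐃 = ⊔_k 𝐃_k, EVERY SCALE ON ITS OWN TORUS
T^{(k)}, as ONE `CubeChart` (leaf L15 of the NE9-P2 skeleton as a tree object; crew item P2-F3 of `t4/T4-NE9-TRIGGER.json` c1;
lineage t4-ne9-p2 = prover P2 «inductive route», generation 19)

HONEST FRAMING (T4-DAG PAGE 1).  Rung (B)+1 on a FIXED finite torus — NOT infinite volume, NOT a mass gap, NOT the Clay problem.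
NE9 is a cell NEW ESTIMATE, NOT PRINTED, NOT discharged here: this module is DATA + lattice GEOMETRY only (site type, adjacency,
carriers, chart, transfer lemmas); it contains NO analytic object of Bałaban's construction and asserts nothing about [I]–[III]
(ABSOLUTE RULE; printed sentences are quoted as TYPES of the data).  `FlowStep.BetaPertH`, (B), (B^μ) do not occur.
TYPES: [I] = [Balaban1987RG1] p. 251 «sequence of tori denoted by T^{(k)}_{L^k ε} and defined by (0.1) with ε replaced by L^k ε»;
p. 257 «Such a domain is a union of a connected, finite family of cubes from π_j», «A length of a shortest graph in this class,
divided by M, is the linear size of X, and is denoted by d_j(X).» (lattice-edge form = tree `linSize`); [II] = [Balaban1988RG2Cluster]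
(2.11) p. 14 (ζ: a common cube or a common wall), (2.30) p. 18 «d_k(Y) ≦ M⁻⁴|Y| − 1» (tree `linSize_le_card_sub_one`).

WHY / WHAT.  The generic END `T4HistoryLipschitzSegment.cubeChart_ne9_and_fadingMemory_of_domainDecay (Γ : CubeChart C α adj D)`
takes ONE site type for all creation steps, while the scale-`k` domains live on `T^{(k)}` with `n k` sites per dimension.  Here:
sites `Σ k : ℕ, (Fin ν → ZMod (n k))`; the SCALE-TAGGED WALL ADJACENCY `SAdj` (same tag, wall-adjacent on that torus — stated
through `ZMod.val`, no dependent cast; `sAdj_mk_iff : SAdj ⟨k,x⟩ ⟨k,y⟩ ↔ torusAdj ν (n k) x y`; decidable, symmetric, degree ≤ 2ν);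
carriers `msCarriers` (domain indices = wall-connected nonempty cube families of every scale, `scale = k`, **`d = linSize` = d_k**;
backgrounds/gauge/transport are PARAMETERS); the chart `msChart` (cubes = the family, region = the whole scale-k torus, both embedded
by `embed k`; `d_le` = (2.30)↑) — so E1 applies VERBATIM with `Γ := msChart …`, every creation step at once; §3 fibre transfer
(`exists_fibre_of_mem_vol`: every step-volume polymer is an embedded wall-connected family of the domain's scale, same cardinality);
§4 `boxMajorantDecay_of_linSizeDecay_ms`: the wall (A″) on this chart in print's d-currency (TYPE [II] Lemma 3 (2.38)) feeds E1's
cube-count binder (as `NE9PrintedMajorantDecay` on one torus); §5 non-vacuity.  DISGUISE TEST: data; no estimate.  0 sorry.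
-/

noncomputable section

namespace Summit.QuantumFields.BalabanUV.T4Continuum.NE9MultiScaleChart

open scoped BigOperators
open MeasureTheory
open Literature.Probability.LatticeModels
open Literature.MathematicalPhysics.QuantumFieldTheory
open Literature.MathematicalPhysics.QuantumFieldTheory.Balaban1983to89
open Literature.MathematicalPhysics.QuantumFieldTheory.Balaban1983to89.T4OutputRate
open Literature.MathematicalPhysics.QuantumFieldTheory.Balaban1983to89.T4HistoryLipschitzActivity (ClusterGeom)
open Literature.MathematicalPhysics.QuantumFieldTheory.Balaban1983to89.T4HistoryLipschitzEntropy
open Literature.MathematicalPhysics.QuantumFieldTheory.Balaban1983to89.T4HistoryLipschitzCubeGeometry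
open Literature.MathematicalPhysics.QuantumFieldTheory.Balaban1983to89.T4HistoryLipschitzSegment
open Literature.MathematicalPhysics.QuantumFieldTheory.Balaban1983to89.T4HistoryLipschitzLinearSize
open Literature.MathematicalPhysics.QuantumFieldTheory.Balaban1983to89.T4HistoryLipschitzRescaling (isConn_image)

/-! ## §1 Multi-scale sites and the scale-tagged wall adjacency -/

section Sites

variable (ν : ℕ) (n : ℕ → ℕ)

/-- **MULTI-SCALE SITES**: a scale tag `k` and a site (lower corner of a big cube) of the scale-k torus `T^{(k)}` with `n k`
sites per dimension ([I] p. 251: the sequence of tori `T^{(k)}`). [cite: Balaban1987RG1, p.251] -/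
abbrev Site : Type := Σ k : ℕ, (Fin ν → ZMod (n k))

/-- **THE SCALE-TAGGED WALL ADJACENCY** — same scale, and on that torus one coordinate differs by `±1` (mod `n k`), the others
agree.  Stated through `ZMod.val` so that no cast between the fibres `ZMod (n k)`, `ZMod (n k′)` is needed; on a fibre it IS
`torusAdj ν (n k)` (`sAdj_mk_iff`).  TYPE: the cube adjacency behind ζ of [II] (2.11) p. 14 («a cube, or a wall of a cube»).
[cite: Balaban1988RG2Cluster, (2.11) p.14] -/
def SAdj (a b : Site ν n) : Prop :=
  a.1 = b.1 ∧ ∃ i : Fin ν, (∀ j : Fin ν, j ≠ i → (a.2 j).val = (b.2 j).val) ∧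
    ((b.2 i).val = ((a.2 i).val + 1) % n a.1 ∨ (a.2 i).val = ((b.2 i).val + 1) % n b.1)

/-- the scale-tagged adjacency is decidable. [folklore] -/
instance instDecidableRelSAdj : DecidableRel (SAdj ν n) := fun a b => by unfold SAdj; infer_instance

/-- the scale-tagged adjacency is symmetric. [folklore] -/
instance instSymmSAdj : Std.Symm (SAdj ν n) :=
  ⟨fun _ _ ⟨hk, i, hj, hi⟩ => ⟨hk.symm, i, fun j hji => (hj j hji).symm, hi.symm⟩⟩

variable {ν n}

/-- `y = x + e_i` coordinatewise. [folklore] -/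
theorem eq_add_single_iff {m : ℕ} (x y : Fin ν → ZMod m) (i : Fin ν) :
    y = x + Pi.single i 1 ↔ y i = x i + 1 ∧ ∀ j : Fin ν, j ≠ i → y j = x j := by
  constructor
  · rintro rfl; exact ⟨by simp, fun j hj => by simp [Pi.single_eq_of_ne hj]⟩
  · rintro ⟨hi, hj⟩; funext j; by_cases h : j = i
    · subst h; simpa using hi
    · simpa [Pi.single_eq_of_ne h] using hj j h

/-- `v = u + 1` in `ZMod m` through the values. [folklore] -/
theorem val_eq_succ_mod_iff {m : ℕ} [NeZero m] (u v : ZMod m) : v = u + 1 ↔ v.val = (u.val + 1) % m := by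
  have key : (u + 1 : ZMod m).val = (u.val + 1) % m := by rw [ZMod.val_add, ZMod.val_one_eq_one_mod, Nat.add_mod_mod]
  exact ⟨fun h => h ▸ key, fun h => ZMod.val_injective m (by rw [h, key])⟩

/-- **ON A FIBRE THE SCALE-TAGGED ADJACENCY IS THE WALL ADJACENCY OF THAT TORUS.** [folklore] -/
theorem sAdj_mk_iff [∀ k, NeZero (n k)] {k : ℕ} (x y : Fin ν → ZMod (n k)) :
    SAdj ν n ⟨k, x⟩ ⟨k, y⟩ ↔ torusAdj ν (n k) x y := by
  constructor
  · rintro ⟨-, i, hj, hi⟩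
    refine ⟨i, ?_⟩
    have hj' : ∀ j : Fin ν, j ≠ i → y j = x j := fun j hji =>
      (ZMod.val_injective (n k) (hj j hji)).symm
    rcases hi with hi | hi
    · left
      exact (eq_add_single_iff x y i).2 ⟨(val_eq_succ_mod_iff (x i) (y i)).2 hi, hj'⟩
    · right
      rw [eq_sub_iff_add_eq]
      exact ((eq_add_single_iff y x i).2 ⟨(val_eq_succ_mod_iff (y i) (x i)).2 hi, fun j hji => (hj' j hji).symm⟩).symm
  · rintro ⟨i, h⟩
    refine ⟨rfl, i, ?_, ?_⟩
    · intro j hji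
      show (x j).val = (y j).val
      rcases h with h | h
      · rw [((eq_add_single_iff x y i).1 h).2 j hji]
      · have h' : x = y + Pi.single i 1 := by rw [h, sub_add_cancel]
        rw [((eq_add_single_iff y x i).1 h').2 j hji]
    · show (y i).val = ((x i).val + 1) % n k ∨ (x i).val = ((y i).val + 1) % n k
      rcases h with h | h
      · exact Or.inl ((val_eq_succ_mod_iff (x i) (y i)).1 ((eq_add_single_iff x y i).1 h).1)
      · have h' : x = y + Pi.single i 1 := by rw [h, sub_add_cancel]
        exact Or.inr ((val_eq_succ_mod_iff (y i) (x i)).1 ((eq_add_single_iff y x i).1 h').1)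

/-- **DEGREE OF THE SCALE-TAGGED ADJACENCY ≤ 2ν** (= 8 on T⁴): the neighbours of `⟨k, x⟩` are among `⟨k, x ± e_i⟩`. [folklore] -/
theorem card_filter_sAdj_le [∀ k, NeZero (n k)] (a : Site ν n) (Q : Finset (Site ν n)) :
    (Q.filter (SAdj ν n a)).card ≤ 2 * ν := by
  classical
  obtain ⟨k, x⟩ := a
  let f : Fin ν × Bool → Site ν n := fun p =>
    ⟨k, if p.2 then x + Pi.single p.1 1 else x - Pi.single p.1 1⟩
  have hsub : Q.filter (SAdj ν n ⟨k, x⟩) ⊆ (Finset.univ : Finset (Fin ν × Bool)).image f := by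
    intro b hb
    obtain ⟨-, hadj⟩ := Finset.mem_filter.1 hb
    obtain ⟨k', y⟩ := b
    have hk : k = k' := hadj.1
    subst hk
    obtain ⟨i, h⟩ := (sAdj_mk_iff x y).1 hadj
    rcases h with h | h
    · exact Finset.mem_image.2 ⟨(i, true), Finset.mem_univ _, by simp [f, h]⟩
    · exact Finset.mem_image.2 ⟨(i, false), Finset.mem_univ _, by simp [f, h]⟩
  calc (Q.filter (SAdj ν n ⟨k, x⟩)).card ≤ ((Finset.univ : Finset (Fin ν × Bool)).image f).card := Finset.card_le_card hsub
    _ ≤ (Finset.univ : Finset (Fin ν × Bool)).card := Finset.card_image_le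
    _ = 2 * ν := by simp [Finset.card_univ, mul_comm]

end Sites

/-! ## §2 The multi-scale carriers and chart -/

section Embed

variable (ν : ℕ) (n : ℕ → ℕ)

/-- the embedding of the scale-`k` torus into the multi-scale sites (`x ↦ ⟨k, x⟩`). [folklore] -/
def embed (k : ℕ) : (Fin ν → ZMod (n k)) ↪ Site ν n :=
  Function.Embedding.sigmaMk (β := fun k => Fin ν → ZMod (n k)) k

/-- the embedding, applied (definitional). [folklore] -/
@[simp] theorem embed_apply (k : ℕ) (x : Fin ν → ZMod (n k)) : embed ν n k x = ⟨k, x⟩ := rfl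

end Embed

section Chart

variable (ν : ℕ) (n : ℕ → ℕ) [∀ k, NeZero (n k)]
variable (BgA BgB : Type) (gauge : BgA → BgA → ℝ) (gauge_nonneg : ∀ U U', 0 ≤ gauge U U') (transport : BgB → BgA)

/-- **THE MULTI-SCALE CARRIERS**: domain indices = (creation step `k`, a WALL-CONNECTED nonempty cube family of `T^{(k)}`)
([I] p. 257 «a union of a connected, finite family of cubes»), `scale = k`, decay length **`d = d_k` = `linSize`** (lattice-edge
linear size, [I] p. 257); backgrounds, closeness gauge and transport are PARAMETERS (the instantiator's).
[cite: Balaban1987RG1, p.257] -/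
def msCarriers : Carriers where
  Dom := Σ k : ℕ, {Y : Finset (Fin ν → ZMod (n k)) // ∃ a ∈ Y, Polymer.IsConn (torusAdj ν (n k)) Y a}
  scale := fun X => X.1
  d := fun X => (linSize X.2.1 : ℝ)
  d_nonneg := fun _ => Nat.cast_nonneg _
  BgA := BgA
  BgB := BgB
  gauge := gauge
  gauge_nonneg := gauge_nonneg
  transport := transport

omit [∀ k, NeZero (n k)] in
/-- creation step of a domain index (definitional). [folklore] -/
@[simp] theorem scale_eq (X : (msCarriers ν n BgA BgB gauge gauge_nonneg transport).Dom) :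
    (msCarriers ν n BgA BgB gauge gauge_nonneg transport).scale X = X.1 := rfl

omit [∀ k, NeZero (n k)] in
/-- decay length of a domain index = the linear size of its cube family (definitional). [folklore] -/
theorem d_eq (X : (msCarriers ν n BgA BgB gauge gauge_nonneg transport).Dom) :
    (msCarriers ν n BgA BgB gauge gauge_nonneg transport).d X = (linSize X.2.1 : ℝ) := rfl

/-- **THE MULTI-SCALE CUBE CHART**: cubes of `X` = its own family embedded at its scale, region = the whole scale-`k` torus,
adjacency `SAdj`, degree `2ν`, `d_le` = (2.30)↑ (`linSize_le_card_sub_one`).  The lineage's END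
`cubeChart_ne9_and_fadingMemory_of_domainDecay` applies to it verbatim. [cite: Balaban1988RG2Cluster, (2.30) p.18; Balaban1987RG1, p.257] -/
def msChart : CubeChart (msCarriers ν n BgA BgB gauge gauge_nonneg transport) (Site ν n) (SAdj ν n) (2 * ν) where
  cubes := fun X => X.2.1.map (embed ν n X.1)
  region := fun X => (Finset.univ : Finset (Fin ν → ZMod (n X.1))).map (embed ν n X.1)
  cubes_sub := fun X => Finset.map_subset_map.2 (Finset.subset_univ _)
  cubes_nonempty := fun X => by
    obtain ⟨a, ha, -⟩ := X.2.2
    exact ⟨⟨X.1, a⟩, Finset.mem_map_of_mem _ ha⟩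
  deg := card_filter_sAdj_le
  d_le := fun X => by
    obtain ⟨a, -, hconn⟩ := X.2.2
    have h1 : linSize X.2.1 ≤ X.2.1.card - 1 := linSize_le_card_sub_one (G := ZMod (n X.1)) hconn
    show (linSize X.2.1 : ℝ) ≤ ((X.2.1.map (embed ν n X.1)).card : ℝ)
    rw [Finset.card_map]; exact_mod_cast h1.trans (Nat.sub_le _ _)

/-- the cubes of a domain index (definitional). [folklore] -/
theorem cubes_eq (X : (msCarriers ν n BgA BgB gauge gauge_nonneg transport).Dom) :
    (msChart ν n BgA BgB gauge gauge_nonneg transport).cubes X = X.2.1.map (embed ν n X.1) := rfl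

/-- the region of a domain index = its whole scale-`k` torus (definitional). [folklore] -/
theorem region_eq (X : (msCarriers ν n BgA BgB gauge gauge_nonneg transport).Dom) :
    (msChart ν n BgA BgB gauge gauge_nonneg transport).region X =
      (Finset.univ : Finset (Fin ν → ZMod (n X.1))).map (embed ν n X.1) := rfl

/-- membership in the region: exactly the sites of the domain's scale. [folklore] -/
theorem mem_region_iff (X : (msCarriers ν n BgA BgB gauge gauge_nonneg transport).Dom) (b : Site ν n) :
    b ∈ (msChart ν n BgA BgB gauge gauge_nonneg transport).region X ↔ b.1 = X.1 := by
  rw [region_eq, Finset.mem_map]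
  constructor
  · rintro ⟨y, -, rfl⟩; rfl
  · intro h
    obtain ⟨k, y⟩ := b
    change k = X.1 at h
    subst h
    exact ⟨y, Finset.mem_univ _, rfl⟩

end Chart

/-! ## §3 Fibre transfer: step-volume polymers are embedded wall-connected families of the domain's scale -/

section Fibre

variable {ν : ℕ} {n : ℕ → ℕ} [∀ k, NeZero (n k)]

/-- A wall-connected scale-`k` family embeds as an `SAdj`-connected family (tree `isConn_image` with `sAdj_mk_iff`). [folklore] -/
theorem isConn_map_sigmaMk {k : ℕ} {Y : Finset (Fin ν → ZMod (n k))} {a : Fin ν → ZMod (n k)}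
    (h : Polymer.IsConn (torusAdj ν (n k)) Y a) :
    Polymer.IsConn (SAdj ν n) (Y.map (embed ν n k)) ⟨k, a⟩ := by
  classical
  have himg : Y.map (embed ν n k) = Y.image (fun x => (⟨k, x⟩ : Site ν n)) := by
    rw [Finset.map_eq_image]; rfl
  rw [himg]
  exact isConn_image (adj' := SAdj ν n) (fun x => (⟨k, x⟩ : Site ν n))
    (fun x _ y _ hxy => Or.inr ((sAdj_mk_iff x y).2 hxy)) h

/-- the projection of a site onto the fibre of scale `k` (the other fibres go to `0`; only the value on the fibre is used).
[folklore] -/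
def fibreProj (k : ℕ) (b : Site ν n) : Fin ν → ZMod (n k) :=
  if b.1 = k then fun i => ((b.2 i).val : ZMod (n k)) else 0

/-- on the fibre the projection is the identity. [folklore] -/
theorem fibreProj_mk {k : ℕ} (x : Fin ν → ZMod (n k)) : fibreProj k (⟨k, x⟩ : Site ν n) = x := by
  funext i
  simp [fibreProj]

/-- the projection undoes the embedding on families. [folklore] -/
theorem image_fibreProj_map {k : ℕ} (Y : Finset (Fin ν → ZMod (n k))) :
    (Y.map (embed ν n k)).image (fibreProj (n := n) k) = Y := by
  classical
  ext x
  constructor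
  · intro hx
    obtain ⟨b, hb, hbx⟩ := Finset.mem_image.1 hx
    obtain ⟨y, hy, rfl⟩ := Finset.mem_map.1 hb
    rw [embed_apply, fibreProj_mk] at hbx
    rw [← hbx]; exact hy
  · intro hx
    exact Finset.mem_image.2 ⟨⟨k, x⟩, Finset.mem_map.2 ⟨x, hx, rfl⟩, fibreProj_mk x⟩

/-- An `SAdj`-connected family INSIDE the fibre of scale `k` projects to a wall-connected family (tree `isConn_image`).
[folklore] -/
theorem isConn_image_fibreProj {k : ℕ} {S : Finset (Site ν n)} {a : Site ν n} (hS : ∀ b ∈ S, b.1 = k)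
    (h : Polymer.IsConn (SAdj ν n) S a) :
    Polymer.IsConn (torusAdj ν (n k)) (S.image (fibreProj k)) (fibreProj k a) := by
  classical
  refine isConn_image (adj := SAdj ν n) (fibreProj k) (fun x hx y hy hxy => Or.inr ?_) h
  obtain ⟨kx, x⟩ := x
  obtain ⟨ky, y⟩ := y
  have hkx : kx = k := hS _ hx
  have hky : ky = k := hS _ hy
  subst hkx; subst hky
  rw [fibreProj_mk, fibreProj_mk]
  exact (sAdj_mk_iff x y).1 hxy

variable (ν n) (BgA BgB : Type) (gauge : BgA → BgA → ℝ) (gauge_nonneg : ∀ U U', 0 ≤ gauge U U') (transport : BgB → BgA)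

/-- **EVERY STEP-VOLUME POLYMER IS AN EMBEDDED WALL-CONNECTED FAMILY OF THE DOMAIN'S SCALE (kernel)**: for `γ ∈ (msChart …).vol X`
(the `SAdj`-connected nonempty families inside the scale-`X.1` torus) there is a wall-connected nonempty family `Y` of
`T^{(X.1)}` with `γ = Y.map (sigmaMk X.1)` — namely `Y = γ.image (fibreProj X.1)`; in particular `#γ = #Y`. [folklore] -/
theorem exists_fibre_of_mem_vol (X : (msCarriers ν n BgA BgB gauge gauge_nonneg transport).Dom) {γ : Finset (Site ν n)}
    (hγ : γ ∈ (msChart ν n BgA BgB gauge gauge_nonneg transport).vol X) :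
    ∃ Y : Finset (Fin ν → ZMod (n X.1)), γ = Y.map (embed ν n X.1) ∧
      (∃ a ∈ Y, Polymer.IsConn (torusAdj ν (n X.1)) Y a) ∧ Y.card = γ.card := by
  classical
  obtain ⟨hsub, a, ha, hconn⟩ := ((msChart ν n BgA BgB gauge gauge_nonneg transport).mem_vol).1 hγ
  have hS : ∀ b ∈ γ, b.1 = X.1 := fun b hb =>
    (mem_region_iff ν n BgA BgB gauge gauge_nonneg transport X b).1 (hsub hb)
  refine ⟨γ.image (fibreProj X.1), ?_, ⟨fibreProj X.1 a, Finset.mem_image_of_mem _ ha, isConn_image_fibreProj hS hconn⟩, ?_⟩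
  · ext b
    constructor
    · intro hb
      obtain ⟨kb, y⟩ := b
      have hk : kb = X.1 := hS _ hb
      subst hk
      exact Finset.mem_map.2 ⟨y, Finset.mem_image.2 ⟨⟨X.1, y⟩, hb, fibreProj_mk y⟩, rfl⟩
    · intro hb
      obtain ⟨y, hy, rfl⟩ := Finset.mem_map.1 hb
      obtain ⟨b', hb', hyb⟩ := Finset.mem_image.1 hy
      obtain ⟨kb', y'⟩ := b'
      have hk : kb' = X.1 := hS _ hb'
      subst hk
      rw [fibreProj_mk] at hyb
      subst hyb
      exact hb'
  · refine Finset.card_image_of_injOn fun b hb b' hb' hbb => ?_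
    obtain ⟨kb, y⟩ := b
    obtain ⟨kb', y'⟩ := b'
    have hk : kb = X.1 := hS _ hb
    have hk' : kb' = X.1 := hS _ hb'
    subst hk; subst hk'
    rw [fibreProj_mk, fibreProj_mk] at hbb
    rw [hbb]

end Fibre

/-! ## §4 The wall (A″) on the multi-scale chart in print's d-currency -/

section PrintedDecay

variable {ν : ℕ} {n : ℕ → ℕ} [∀ k, NeZero (n k)]

/-- **THE LINEAR SIZE OF A POLYMER OF THE MULTI-SCALE CHART**, read on the fibre of scale `k`: `d(γ) := linSize (γ.image
(fibreProj k))` — for an embedded scale-`k` family `Y.map (sigmaMk k)` this is `linSize Y` = Bałaban's `d_k` (lattice-edge form).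
[cite: Balaban1987RG1, p.257] -/
def fibreLinSize (k : ℕ) (γ : Finset (Site ν n)) : ℕ := linSize (γ.image (fibreProj (n := n) k))

/-- on an embedded family the fibre linear size is the family's linear size. [folklore] -/
theorem fibreLinSize_map {k : ℕ} (Y : Finset (Fin ν → ZMod (n k))) :
    fibreLinSize (n := n) k (Y.map (embed ν n k)) = linSize Y := by
  rw [fibreLinSize, image_fibreProj_map]

variable (ν n) (BgA BgB : Type) (gauge : BgA → BgA → ℝ) (gauge_nonneg : ∀ U U', 0 ≤ gauge U U') (transport : BgB → BgA)
variable {F : Type*} [Fintype F] {Ω : Type*} [MeasurableSpace Ω] {Sp : Type*}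

/-- **(A″) IN PRINT'S CURRENCY ON THE MULTI-SCALE CHART FEEDS THE END'S CUBE-COUNT BINDER (kernel)** — the multi-scale twin of
`NE9PrintedMajorantDecay.boxMajorantDecay_of_linSizeDecay`: every step-volume polymer `γ′` of a domain `X` is an embedded
wall-connected family `Y` of the scale of `X` (§3), so `e^{−a′·d(γ′)} ≤ e^{a′}·(e^{−a′/2^ν})^{#γ′}` with `d = fibreLinSize X.1`
(`exp_neg_mul_linSize_le`, the corrected lower half of (2.30)); hence decay `ε′ k·e^{−a′·d(γ′)}` of the box majorant (TYPE: [II]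
Lemma 3 (2.38) p. 20 `|H(Z)| ≤ C₃ε₁ exp(−(1 − 8δ)½Lκd_{k+1}(Z))`, ONE table; class-uniform form displayed) gives the `hdecay₀` binder
of `cubeChart_ne9_and_fadingMemory_of_domainDecay (msChart …)` with `ε k = ε′ k·e^{a′}`, `y = e^{−a′/2^ν}`.
[cite: Balaban1988RG2Cluster, Lemma 3 (2.38) p.20 and (2.30) p.18; Balaban1987RG1, p.257] -/
theorem boxMajorantDecay_of_linSizeDecay_ms {Bg : Type} {W : Set (ℕ → ℝ)}
    {μ : ℕ → ℝ → Bg → Finset (Site ν n) → Measure Ω} {pre : ℕ → ℝ → Bg → Finset (Site ν n) → Ω → ℂ}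
    {c : ℕ → ℝ → Bg → Finset (Site ν n) → Ω → F → ℂ}
    {pt : ℕ → ℝ → Bg → Finset (Site ν n) → Ω → F → Sp} {β : ℕ → Sp → ℝ} {ε' : ℕ → ℝ} {a' : ℝ}
    (hε' : ∀ k, 0 ≤ ε' k) (ha' : 0 ≤ a')
    (hdecayLin : ∀ g ∈ W, ∀ (k : ℕ) (U : Bg) (X : (msCarriers ν n BgA BgB gauge gauge_nonneg transport).Dom),
      (msCarriers ν n BgA BgB gauge gauge_nonneg transport).scale X = k + 1 →
      ∀ γ' ∈ (msChart ν n BgA BgB gauge gauge_nonneg transport).vol X,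
        ∫ ω, ‖pre k (g k) U γ' ω‖ * Real.exp (boxExponent c pt β k (g k) U γ' ω) ∂(μ k (g k) U γ') ≤
          ε' k * Real.exp (-(a' * (fibreLinSize X.1 γ' : ℝ)))) :
    ∀ g ∈ W, ∀ (k : ℕ) (U : Bg) (X : (msCarriers ν n BgA BgB gauge gauge_nonneg transport).Dom),
      (msCarriers ν n BgA BgB gauge gauge_nonneg transport).scale X = k + 1 →
      ∀ γ' ∈ (msChart ν n BgA BgB gauge gauge_nonneg transport).vol X,
        ∫ ω, ‖pre k (g k) U γ' ω‖ * Real.exp (boxExponent c pt β k (g k) U γ' ω) ∂(μ k (g k) U γ') ≤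
          (ε' k * Real.exp a') * Real.exp (-(a' / 2 ^ ν)) ^ γ'.card := by
  intro g hg k U X hX γ' hγ'
  obtain ⟨Y, hY, ⟨b, -, hconn⟩, hcard⟩ := exists_fibre_of_mem_vol ν n BgA BgB gauge gauge_nonneg transport X hγ'
  have hsk : ∃ S, IsSkeleton Y S := ⟨Y, isSkeleton_self_of_isConn (G := ZMod (n X.1)) hconn⟩
  have hd : fibreLinSize X.1 γ' = linSize Y := by rw [hY, fibreLinSize_map]
  calc ∫ ω, ‖pre k (g k) U γ' ω‖ * Real.exp (boxExponent c pt β k (g k) U γ' ω) ∂(μ k (g k) U γ')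
      ≤ ε' k * Real.exp (-(a' * (fibreLinSize X.1 γ' : ℝ))) := hdecayLin g hg k U X hX γ' hγ'
    _ = ε' k * Real.exp (-(a' * (linSize Y : ℝ))) := by rw [hd]
    _ ≤ ε' k * (Real.exp a' * Real.exp (-(a' / 2 ^ ν)) ^ Y.card) :=
        mul_le_mul_of_nonneg_left (exp_neg_mul_linSize_le ha' hsk) (hε' k)
    _ = (ε' k * Real.exp a') * Real.exp (-(a' / 2 ^ ν)) ^ γ'.card := by rw [hcard]; ring

end PrintedDecay

/-! ## §5 Non-vacuity -/

section Examples

/-- A one-cube domain of creation step 3 on the tori `n k = 5` (any backgrounds): its decay length is `d = linSize {0} = 0` and its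
cube set is the embedded singleton. [folklore] -/
example : ∃ X : (msCarriers 4 (fun _ => 5) Unit Unit (fun _ _ => 0) (fun _ _ => le_rfl) id).Dom,
    (msCarriers 4 (fun _ => 5) Unit Unit (fun _ _ => 0) (fun _ _ => le_rfl) id).scale X = 3 ∧
      (msCarriers 4 (fun _ => 5) Unit Unit (fun _ _ => 0) (fun _ _ => le_rfl) id).d X = 0 := by
  refine ⟨⟨3, ⟨{0}, 0, Finset.mem_singleton_self _, Polymer.isConn_singleton 0⟩⟩, rfl, ?_⟩
  show ((linSize ({0} : Finset (Fin 4 → ZMod 5)) : ℕ) : ℝ) = 0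
  rw [linSize_singleton]; simp

/-- Wall-neighbours of one scale ARE adjacent; sites of different scales NEVER are. [folklore] -/
example : SAdj 4 (fun _ => 5) ⟨2, 0⟩ ⟨2, Pi.single 0 1⟩ ∧ ¬ SAdj 4 (fun _ => 5) ⟨2, 0⟩ ⟨3, 0⟩ :=
  ⟨(sAdj_mk_iff (n := fun _ => 5) (0 : Fin 4 → ZMod 5) (Pi.single 0 1)).2 ⟨0, Or.inl (by simp)⟩,
    fun h => absurd h.1 (by simp)⟩

end Examples

end Summit.QuantumFields.BalabanUV.T4Continuum.NE9MultiScaleChart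

end
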